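import Literature.MathematicalPhysics.QuantumFieldTheory.Balaban1983to89.B8Thm2TorusAt
import Literature.MathematicalPhysics.QuantumFieldTheory.Balaban1983to89.B8ScaledSupNorm
import Literature.MathematicalPhysics.QuantumFieldTheory.Balaban1983to89.B12Ineq417Flat

/-!
# `Balaban1983to89.B8TorusShiftStencils` — translation covariance of the LOCAL STENCILS of [Balaban1985RegularSpaces] §1 ∕ §3 on `ℤᵈ`
# (the covariant derivatives (1.1)–(1.2), the covariant divergence and Laplacian ([4] (3.23)), the exterior covariant derivative ([4] (3.4)) and its
# divergence, the exponential chart `e^{iηA}` and its logarithm, the Hölder quotient ([4] (3.40))) and of the weighted sup norms of p. 86 — the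
# stencil half of the PERIODICITY JOINT of the [B8] §3 Theorem-2 torus supplier (sub-row «G-B8-T2S», module M1a of `lit-balaban-p33/T2S-MAP.md`)

statement-level skeleton of published theorems with citation tags; proofs where landed; nothing here is a claim about the
Yang–Mills mass gap

T. Bałaban, *Spaces of regular gauge field configurations on a lattice and gauge fixing conditions*, Commun. Math. Phys. **99** (1985) 75–102
`[Balaban1985RegularSpaces]` ("B8"; printed page = PDF page + 74): (1.1)–(1.2) p. 76, (1.36)–(1.39) pp. 82–83, p. 86 (the norms `|·|₍α₎`); T. Bałaban,
*Propagators for lattice gauge theories in a background field*, Commun. Math. Phys. **99** (1985) 389–434 `[Balaban1985BackgroundPropagators]` ([4];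
(3.4) p. 391, (3.23) p. 394, (3.40) p. 397); T. Bałaban, *Renormalization group approach to lattice gauge field theories. I*, Commun. Math. Phys.
**109** (1987) 249–301 `[Balaban1987RG1]` ((4.16) p. 285: «translation invariant, i.e., Q(ηA, x + a) = Q(ηt_aA, x)» — the tree's `shiftCfg`).

CITATION HEADER (lean-in-tree rule).  Cell `lit-balaban`, seat `lit-balaban-p33` (gen 90), sub-row «G-B8-T2S» ([B8] §3 Theorem 2 torus supplier for
R3 `stmt-QuantumFields-19200`), module M1a.  WHY: the interface of record `B8Thm2TorusAt.Thm2TorusAt` reads the torus `T_η` as `P`-PERIODIC data on `ℤᵈ`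
and wants a `P`-periodic gauge transformation; the landed `ℤᵈ` knit produces `u` through `∃`.  Route P1 of the map: the knit's Theorem 2 carries UNIQUENESS,
so `x ↦ u(x + P•eᵢ)` equals `u` as soon as every clause of the conclusion is COVARIANT under the translation `t_a` (`B12Ineq417Flat.shiftCfg a`,
`(t_aF)(x) = F(x + a)`) jointly in the background and the field.  This file proves that covariance for the local stencils and the p. 86 norms
(elementary: each stencil at `x` reads its arguments at `x`, `x ± e_μ`; a translation re-indexes the suprema); the block-recursive objects ((1.29)
`Restr129`, the adjoint averaging in (1.38), (1.37) — `B7TranslationCovariance.logCovIter_shiftCfg` is already in the tree) are module M1b.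
WHAT IS PROVED (kernel, 0 sorry, theorems only, no `def`, no `… : Prop` fact, no existing module modified): `covDerivFwd_shiftCfg`, `covDeriv_shiftCfg`,
`covDivB_shiftCfg`, `covLap_shiftCfg`, `plaqCovDeriv_shiftCfg`, `pdiv_shiftCfg`, `cfgExp_shiftCfg'`, `logCfg_shiftCfg`, `trans_shiftCfg`, `hquot_shiftCfg`,
`admPair_shift_iff`, `msup_reindex` (re-indexing a p. 86 norm along an equivalence respecting the level membership), `msup_shift_univ`,
`bondNorm_shiftCfg_univ`.

HONEST SCOPE.  Elementary bookkeeping about the tree's concrete `ℤᵈ` objects; the printed sources state translation invariance only for the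
averaging operations ([Balaban1987RG1] (4.16)); nothing of Theorem 2 is proved here; `T_η ↦ ℤᵈ`; count-neutral; nothing continuum ∕ ℝ⁴ ∕ OS ∕
mass-gap ∕ Clay.
-/

noncomputable section

open NormedSpace
open scoped BigOperators

namespace Literature.MathematicalPhysics.QuantumFieldTheory.Balaban1983to89.B8TorusShiftStencils

open B7Prop1Explicit (e hol treeWord)
open B7Eq78Linearization (conjR)
open B8Ineq132 (covDerivFwd covDeriv BondTouches)
open B8Eq184Proof (cfgExp)
open B8Eq146AExpansion (plaqCovDeriv plaqCovDeriv_eq_covDerivFwd)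
open B8Eq143PlaqExpansion (pdiv)
open B8Eq138LandauZd (covDivB covLap logCfg)
open B9Eq340HolderZd (hquot AdmPair trans mem_admPair)
open B8ScaledSupNorm (msup bondNorm weight Idx)
open B12Ineq417Flat (shiftCfg shiftCfg_apply hol_shiftCfg)

-- the `ℤ^d` sites of `B7Prop1Explicit` are `LSite` here (convention of `B8Thm2TorusAt`).
open B7Prop1Explicit renaming Site → LSite

variable {d : ℕ}

/-! ## §1  The local stencils -/

section Stencils

variable {𝔸 : Type*} [NormedRing 𝔸] [NormedAlgebra ℂ 𝔸]

/-- **(1.1) is translation covariant**: `(D^η_{t_aU₀,μ}(t_aF))(x) = (D^η_{U₀,μ}F)(x + a)`. [cite: Balaban1985RegularSpaces, (1.1) p.76; Balaban1987RG1, (4.16) p.285] -/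
theorem covDerivFwd_shiftCfg (η : ℝ) (a : LSite d) (V : LSite d → Fin d → 𝔸ˣ) (μ : Fin d) (F : LSite d → 𝔸) (x : LSite d) :
    covDerivFwd η (shiftCfg a V) μ (shiftCfg a F) x = covDerivFwd η V μ F (x + a) := by
  simp only [covDerivFwd, shiftCfg_apply, add_right_comm x (e μ) a]

/-- **(1.2) (the backward derivative entering `D^{η*}`) is translation covariant.** [cite: Balaban1985RegularSpaces, (1.2) p.76; Balaban1987RG1, (4.16) p.285] -/
theorem covDeriv_shiftCfg (η : ℝ) (a : LSite d) (V : LSite d → Fin d → 𝔸ˣ) (ν : Fin d) (F : LSite d → 𝔸) (x : LSite d) :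
    covDeriv η (shiftCfg a V) ν (shiftCfg a F) x = covDeriv η V ν F (x + a) := by
  simp only [covDeriv, shiftCfg_apply, add_sub_right_comm x a (e ν)]

/-- **The covariant divergence `D^{η*}_{U₀}A = Σ_μ D^{η*}_{U₀,μ}A_μ` is translation covariant.** [cite: Balaban1985BackgroundPropagators, (3.23) p.394; Balaban1987RG1, (4.16) p.285] -/
theorem covDivB_shiftCfg (η : ℝ) (a : LSite d) (V : LSite d → Fin d → 𝔸ˣ) (A : LSite d → Fin d → 𝔸) (x : LSite d) :
    covDivB η (shiftCfg a V) (shiftCfg a A) x = covDivB η V A (x + a) := by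
  unfold covDivB
  refine Finset.sum_congr rfl fun μ _ => ?_
  exact covDeriv_shiftCfg η a V μ (fun z => A z μ) x

/-- **The covariant Laplacian `Δ^η_{U₀} = Σ_μ D^{η*}_{U₀,μ}D^η_{U₀,μ}` is translation covariant.** [cite: Balaban1985BackgroundPropagators, (3.23) p.394; Balaban1987RG1, (4.16) p.285] -/
theorem covLap_shiftCfg (η : ℝ) (a : LSite d) (V : LSite d → Fin d → 𝔸ˣ) (f : LSite d → 𝔸) (x : LSite d) :
    covLap η (shiftCfg a V) (shiftCfg a f) x = covLap η V f (x + a) := by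
  unfold covLap
  have h : (fun z μ => covDerivFwd η (shiftCfg a V) μ (shiftCfg a f) z) = shiftCfg a (fun z μ => covDerivFwd η V μ f z) := by
    funext z μ
    rw [covDerivFwd_shiftCfg, shiftCfg_apply]
  rw [h, covDivB_shiftCfg]

/-- **The exterior covariant derivative (3.4) of [4] is translation covariant.** [cite: Balaban1985BackgroundPropagators, (3.4) p.391; Balaban1987RG1, (4.16) p.285] -/
theorem plaqCovDeriv_shiftCfg (η : ℝ) (a : LSite d) (V : LSite d → Fin d → 𝔸ˣ) (A : LSite d → Fin d → 𝔸) (μ ν : Fin d) (x : LSite d) :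
    plaqCovDeriv η (shiftCfg a V) (shiftCfg a A) μ ν x = plaqCovDeriv η V A μ ν (x + a) := by
  rw [plaqCovDeriv_eq_covDerivFwd, plaqCovDeriv_eq_covDerivFwd]
  exact congrArg₂ (· - ·) (covDerivFwd_shiftCfg η a V μ (fun y => A y ν) x) (covDerivFwd_shiftCfg η a V ν (fun y => A y μ) x)

/-- **The divergence `D^{η*}_{U₀}F` of a plaquette field (the (1.39) member `D^{η*}D^ηA`) is translation covariant.** [cite: Balaban1985RegularSpaces, (1.39) p.83, (1.2) p.76; Balaban1987RG1, (4.16) p.285] -/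
theorem pdiv_shiftCfg (η : ℝ) (a : LSite d) (V : LSite d → Fin d → 𝔸ˣ) (F : Fin d → Fin d → LSite d → 𝔸) (μ : Fin d) (x : LSite d) :
    pdiv η (shiftCfg a V) (fun ν κ => shiftCfg a (F ν κ)) μ x = pdiv η V F μ (x + a) := by
  unfold pdiv
  simp only [covDeriv_shiftCfg]

/-- `D^{η*}D^η` of a translated pair: the composite (1.39)₁ stencil is translation covariant. [cite: Balaban1985RegularSpaces, (1.39) p.83; Balaban1987RG1, (4.16) p.285] -/
theorem pdiv_plaqCovDeriv_shiftCfg (η : ℝ) (a : LSite d) (V : LSite d → Fin d → 𝔸ˣ) (A : LSite d → Fin d → 𝔸) (μ : Fin d) (x : LSite d) :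
    pdiv η (shiftCfg a V) (plaqCovDeriv η (shiftCfg a V) (shiftCfg a A)) μ x = pdiv η V (plaqCovDeriv η V A) μ (x + a) := by
  have h : plaqCovDeriv η (shiftCfg a V) (shiftCfg a A) = fun ν κ => shiftCfg a (plaqCovDeriv η V A ν κ) := by
    funext ν κ z
    rw [plaqCovDeriv_shiftCfg, shiftCfg_apply]
  rw [h, pdiv_shiftCfg]

omit [NormedAlgebra ℂ 𝔸] in
/-- **The parallel transport of the Hölder quotient (3.40) is translation covariant**: `U(Γ_{x,x′})` for `t_aU₀` at `(x, x′)` is `U₀(Γ_{x+a,x′+a})`.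
[cite: Balaban1985BackgroundPropagators, (3.40) p.397] -/
theorem trans_shiftCfg (a : LSite d) (U₀ : LSite d → Fin d → 𝔸ˣ) (x x' : LSite d) (X : 𝔸) :
    B9Eq340HolderZd.trans (shiftCfg a U₀) x x' X = B9Eq340HolderZd.trans U₀ (x + a) (x' + a) X := by
  unfold B9Eq340HolderZd.trans
  rw [hol_shiftCfg, add_sub_add_right_eq_sub]

omit [NormedAlgebra ℂ 𝔸] in
/-- **The Hölder quotient (3.40) is translation covariant** (`len` enters through the difference `x′ − x` only).
[cite: Balaban1985BackgroundPropagators, (3.40) p.397; Balaban1985RegularSpaces, (1.36) p.82] -/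
theorem hquot_shiftCfg (η β : ℝ) (len : LSite d → ℝ) (a : LSite d) (U₀ : LSite d → Fin d → 𝔸ˣ) (F : LSite d → 𝔸) (p : LSite d × LSite d) :
    hquot η β len (shiftCfg a U₀) (shiftCfg a F) p = hquot η β len U₀ F (p.1 + a, p.2 + a) := by
  unfold hquot
  rw [trans_shiftCfg, shiftCfg_apply, shiftCfg_apply, add_sub_add_right_eq_sub]

omit [NormedAlgebra ℂ 𝔸] in
/-- **The admissible pairs of (3.40) are translation invariant** (`|x − x′| ≤ 1` in the printed units). [cite: Balaban1985BackgroundPropagators, (3.40) p.397] -/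
theorem admPair_shift_iff (η : ℝ) (len : LSite d → ℝ) (a : LSite d) (p : LSite d × LSite d) :
    (p.1 + a, p.2 + a) ∈ AdmPair η len ↔ p ∈ AdmPair η len := by
  simp only [mem_admPair, add_sub_add_right_eq_sub]

end Stencils

section Chart

variable {𝔸 : Type*} [NormedRing 𝔸] [NormedAlgebra ℂ 𝔸] [CompleteSpace 𝔸]

/-- **The exponential chart `e^{iηA}` commutes with translations** (bondwise). [cite: Balaban1985RegularSpaces, (1.36) p.82 («U₁ = exp iηA»)] -/
theorem cfgExp_shiftCfg' (η : ℝ) (a : LSite d) (A : LSite d → Fin d → 𝔸) : cfgExp η (shiftCfg a A) = shiftCfg a (cfgExp η A) := rfl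

omit [CompleteSpace 𝔸] in
/-- **The logarithm `(iη)⁻¹ log W` commutes with translations** (bondwise). [cite: Balaban1985RegularSpaces, (1.36) p.82 («U₁ = exp iηA»)] -/
theorem logCfg_shiftCfg (η : ℝ) (a : LSite d) (W : LSite d → Fin d → 𝔸ˣ) : logCfg η (shiftCfg a W) = shiftCfg a (logCfg η W) := rfl

end Chart


/-! ## §2  The weighted sup norms of p. 86 -/

section Norms

variable {ι ι' : Type*} {E : Type*} [SeminormedAddCommGroup E]

/-- **Re-indexing a p. 86 norm `|F|₍α₎ = sup_j sup_{Ω_j} (Lʲη)^{−α}|F|`** along an equivalence of the carriers respecting the level membership leaves it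
unchanged (a supremum over an equivalent index set). [cite: Balaban1985RegularSpaces, p.86 (definition after (1.55))] -/
theorem msup_reindex (L k : ℕ) (η α : ℝ) (mem : ℕ → ι → Prop) (mem' : ℕ → ι' → Prop) (σ : ι ≃ ι')
    (hmem : ∀ j i, mem j i ↔ mem' j (σ i)) (F : ι' → E) :
    msup L k η α mem (fun i => F (σ i)) = msup L k η α mem' F := by
  unfold msup
  let τ : Idx k mem ≃ Idx k mem' :=
    { toFun := fun p => ⟨(p.1.1, σ p.1.2), p.2.1, (hmem _ _).1 p.2.2⟩
      invFun := fun q => ⟨(q.1.1, σ.symm q.1.2), q.2.1, (hmem _ _).2 (by simpa using q.2.2)⟩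
      left_inv := fun p => Subtype.ext (by simp)
      right_inv := fun q => Subtype.ext (by simp) }
  exact Equiv.iSup_congr τ fun p => rfl

/-- **A p. 86 norm over ALL of `ℤᵈ` at every level (`Ω_j = T_η`) is translation invariant**: for a membership predicate transported by a bijection
`σ` of the carrier (`mem j i ↔ mem j (σ i)`), `|F ∘ σ|₍α₎ = |F|₍α₎`. [cite: Balaban1985RegularSpaces, p.86 (definition after (1.55)), p.77 («Ω_j = T_η»)] -/
theorem msup_shift_univ (L k : ℕ) (η α : ℝ) (mem : ℕ → ι → Prop) (σ : ι ≃ ι) (hmem : ∀ j i, mem j i ↔ mem j (σ i)) (F : ι → E) :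
    msup L k η α mem (fun i => F (σ i)) = msup L k η α mem F :=
  msup_reindex L k η α mem mem σ hmem F

/-- **The bond norm `|A|₍α₎` over `Ω_j = ℤᵈ` is translation invariant**: `|t_aA|₍α₎ = |A|₍α₎`. [cite: Balaban1985RegularSpaces, p.86 (definition after (1.55)), p.77 («Ω_j = T_η»)] -/
theorem bondNorm_shiftCfg_univ (L k : ℕ) (η α : ℝ) (a : LSite d) (A : LSite d → Fin d → E) :
    bondNorm L k η α (fun _ => (Set.univ : Set (LSite d))) (shiftCfg a A) = bondNorm L k η α (fun _ => (Set.univ : Set (LSite d))) A := by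
  unfold bondNorm
  let σ : LSite d × Fin d ≃ LSite d × Fin d :=
    { toFun := fun b => (b.1 + a, b.2)
      invFun := fun b => (b.1 - a, b.2)
      left_inv := fun b => by simp
      right_inv := fun b => by simp }
  have h := msup_shift_univ L k η α (fun _ (b : LSite d × Fin d) => BondTouches (Set.univ : Set (LSite d)) b.1 b.2) σ
    (fun j b => by simp [BondTouches, σ]) (fun b => A b.1 b.2)
  simpa [σ, shiftCfg_apply] using h

end Norms

#print axioms covLap_shiftCfg
#print axioms hquot_shiftCfg
#print axioms msup_reindex
#print axioms bondNorm_shiftCfg_univ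

end Literature.MathematicalPhysics.QuantumFieldTheory.Balaban1983to89.B8TorusShiftStencils

end
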